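import Literature.NumberTheory.EllipticCurves.TakahashiDegreeFormulaCoprimeProofs
import Literature.NumberTheory.EllipticCurves.ModularCurveManinSemistableProofs
import Literature.NumberTheory.EllipticCurves.CuspFormLFunctionLevelConductorProofs
import HarnessLib

/-!
# Takahashi 2001, Thm. 2.3: from "datum of minimal degree" to "the optimal quotient"
# (the fact from the character-group dictionary for LATTICE-OPTIMAL data)

Topic `Literature/NumberTheory/EllipticCurves`; theorems only (no definition, no named fact).
Sibling of `TakahashiDegreeFormula.lean` (the NAMED FACTS `takahashi2001_thm_2_3`,
`takahashi2001_thm_2_3_of_coprime`), `TakahashiDegreeFormulaProofs.lean` (the algebra of §2),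
`TakahashiDegreeFormulaSetupProofs.lean` / `TakahashiDegreeFormulaCoprimeProofs.lean` (setup
independence; the facts from the dictionary `H` for data of minimal degree).

Takahashi's `δ = δ_1(N)` (J. Number Theory 90 (2001), p. 78) is the integer `π ∘ π^∨` of the
OPTIMAL QUOTIENT `π : J₀(N) → E`; the named facts render "`E` optimal, `δ` its degree" isogeny-free
as "a parametrisation datum `P` of `W` of minimal degree among all data with the same newform"
(module docstring (i) of `TakahashiDegreeFormula.lean`). Over the tree the passage between the two
is a theorem of complex tori, already used for the Manin constant and for Ribet's
`deg ∣ congruence number` (`ModularCurveManinSemistableProofs.lean`,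
`CongruenceNumberRibetProofs.lean`): `φ_P` factors as the Eichler–Shimura map `Y₀(N) → ℂ/Λ_f`
followed by the isogeny `z ↦ c z : ℂ/Λ_f → ℂ/Λ_W`, so `deg φ_P = [Λ_W : c Λ_f] · deg(Y₀(N) → ℂ/Λ_f)`
(`modularDegree_eq_card_ker_mul`), and `P` has minimal degree iff it is **lattice-optimal**,
`c Λ_f = Λ_W` (`latticeEq_of_modularDegree_le`, `modularDegree_le_of_isogenyMap_ker_eq_bot`) —
i.e. `W ≅ E_f = ℂ/Λ_f` is the strong Weil curve and `φ_P` its optimal parametrisation (Knapp 1993,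
Prop. 12.9(a) and p. 302) — granted ONE printed input, the Eichler–Shimura construction with its
period lattice (`hES` below, verbatim the hypothesis of
`ModularParametrizationData.exists_optimalDatum`: a `ℚ`-model `W₀` of `E_f` with `IsNewformOf W₀ f`
whose Néron-type lattice is `Λ_f`; Knapp 1993, Thm. 11.74 (c)–(d), Thm. 12.8; Cremona 1997 §2.14).

This file carries that step out for Takahashi's facts:

* `ModularParametrizationData.modularDegree_eq_of_latticeEq` — **`δ` is intrinsic**: two
  lattice-optimal data with the same newform (of possibly different `ℚ`-models) have the same
  degree (the degree of `Y₀(N) → ℂ/Λ_f`).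
* `ModularParametrizationData.latticeEq_of_forall_conductor_modularDegree_le` — **minimal degree
  among the data of the curves of conductor `N` forces lattice-optimality**, granted `hES` and
  Carayol's level theorem `IsNewformOf.level_eq_conductorNorm` at level `N` (the tree's named
  fact; needed only to see that the optimal model `W₀` has conductor `N`, so that the restricted
  minimality hypothesis of `takahashi2001_thm_2_3_of_coprime` applies to it; over the tree it
  follows from modularity `exists_isNewformOf`, `IsNewformOf.level_eq_conductorNorm_of_exists_isNewformOf'`).
* `takahashi2001_thm_2_3_of_coprime_of_optimalDictionary` — **the `r ∥ N` fact from the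
  character-group dictionary for lattice-optimal data**: hypothesis `H` is the hypothesis of
  `takahashi2001_thm_2_3_of_coprime_of_brandtDictionary_one` with "`P` of minimal degree"
  replaced by "`P` lattice-optimal (`Λ_W ⊆ c Λ_f`)", which is exactly Takahashi's setting (`W` a
  `ℚ`-model of the optimal quotient `E_f`, `φ_P` the optimal parametrisation, `P.modularDegree = δ`
  with `π ∘ π^∨ = δ`); plus `hES` and Carayol. `takahashi2001_thm_2_3_of_coprime_of_optimalDictionary'`
  takes modularity `exists_isNewformOf` in place of Carayol.
* `takahashi2001_thm_2_3_of_optimalDictionary` — the same for the square-free fact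
  `takahashi2001_thm_2_3` (no Carayol needed: its minimality hypothesis is unrestricted).

So what a discharge of either fact must still supply is `hES` (open in the tree, shared with the
Manin-constant and congruence-number reductions) and the dictionary for the optimal quotient:
(M1) Néron models / character groups / Grothendieck's pairing with adjointness of `π^*, π_*`
[SGA7 IX 11.5], (M2') `π_* π^* =` the analytic degree of the optimal parametrisation, (M4) Ribet's
isometry `X_r(J₀(Mr)) ≅ ℤ[Cls O]⁰`, (M5) multiplicity one. Nothing is discharged; no statement of
the tree is changed; no new named fact.

## References

* [Takahashi2001] S. Takahashi, J. Number Theory 90 (2001) 74–88, doi:10.1006/jnth.2000.2614 —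
  §2 p. 78 (definition of `δ`), Thm. 2.3 (p. 79), remark p. 80, proof of Thm. 3.8 (p. 84). READ.
* [Knapp1993] A. W. Knapp, *Elliptic curves*, Princeton 1993: Thm. 11.74, Thm. 12.8, Prop. 12.9
  and p. 302.
* [CremonaAlgorithms1997] J. E. Cremona, *Algorithms for modular elliptic curves*, 2nd ed.,
  §2.14.
* [Carayol1986] H. Carayol, Ann. Sci. ÉNS 19 (1986) (level = conductor).
-/

noncomputable section

open scoped MatrixGroups ModularForm

open CongruenceSubgroup

namespace Literature.NumberTheory.EllipticCurves

open Literature.NumberTheory.Automorphic Literature.NumberTheory.EllipticCurves.ModularForms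

/-! ### Lattice-optimal data: `δ` is intrinsic, and minimal degree forces lattice-optimality -/

namespace ModularForms.ModularParametrizationData

variable {N : ℕ} [NeZero N]

/-- **`δ` is intrinsic.** Two lattice-optimal data (`Λ ⊆ c Λ_f`, i.e. `c Λ_f = Λ`: the isogeny
`z ↦ c z : ℂ/Λ_f → ℂ/Λ` is an isomorphism) with the same newform — of possibly different
`ℚ`-models `W`, `W'` — have the same modular degree: each has degree at most the other's
(`modularDegree_le_of_isogenyMap_ker_eq_bot`). This common value is the degree of the
Eichler–Shimura map `Y₀(N) → ℂ/Λ_f`, Takahashi's `δ = δ_1(N)` of the optimal quotient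
(`π ∘ π^∨ = δ`, p. 78). [cite: Knapp1993, Prop. 12.9(a) and p. 302] -/
theorem modularDegree_eq_of_latticeEq {W W' : WeierstrassCurve ℚ}
    (P : ModularParametrizationData W N) (P' : ModularParametrizationData W' N) (hf : P'.f = P.f)
    (h : ∀ z ∈ P.L.lattice, ∃ w ∈ periodLattice P.f, z = P.c * w)
    (h' : ∀ z ∈ P'.L.lattice, ∃ w ∈ periodLattice P'.f, z = P'.c * w) :
    P.modularDegree = P'.modularDegree :=
  le_antisymm
    (P.modularDegree_le_of_isogenyMap_ker_eq_bot (P.isogenyMap_ker_eq_bot_iff.mpr h) P' hf)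
    (P'.modularDegree_le_of_isogenyMap_ker_eq_bot (P'.isogenyMap_ker_eq_bot_iff.mpr h') P hf.symm)

/-- **Minimal degree among the data of the curves of conductor `N` forces lattice-optimality.**
Assume (`hES`) the Eichler–Shimura construction with its period lattice (verbatim the hypothesis
of `exists_optimalDatum`: Knapp 1993, Thm. 11.74 (c)–(d) with Thm. 12.8, Prop. 12.9(a), p. 302)
and Carayol's level theorem at level `N` (`IsNewformOf.level_eq_conductorNorm`, the tree's named
fact). If `deg φ_P ≤ deg φ_{P'}` for every datum `P'`, at level `N`, of every elliptic `W'/ℚ` of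
conductor `N` with the same newform — the minimality hypothesis of
`takahashi2001_thm_2_3_of_coprime` — then `P` is lattice-optimal: `Λ_W ⊆ c Λ_f` (hence
`c Λ_f = Λ_W`). Proof: an optimal datum `D₀` of a model `W₀` of `E_f` exists (`exists_optimalDatum`);
`W₀` has conductor `N` (Carayol, from `IsNewformOf W₀ f`); so `deg φ_P ≤ deg φ_{D₀}` and
`latticeEq_of_modularDegree_le` applies. [cite: Knapp1993, Prop. 12.9(a) and p. 302] [cite: Carayol1986] -/
theorem latticeEq_of_forall_conductor_modularDegree_le
    (hES : ∀ {N : ℕ} [NeZero N] {f : CuspForm (Gamma0 N) 2}, IsNewform0 f →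
      (∀ n : ℕ, ∃ a : ℤ, cuspCoeff f n = a) →
      ∃ (W₀ : WeierstrassCurve ℚ) (_ : W₀.IsElliptic), IsNewformOf W₀ f ∧
        ∃ L₀ : PeriodPair, IsNeronLatticeOf (W₀.baseChange ℂ) L₀ ∧
          (L₀.lattice : Set ℂ) = periodLattice f)
    (hCar : IsNewformOf.level_eq_conductorNorm (N := N))
    {W : WeierstrassCurve ℚ} [W.IsElliptic] (P : ModularParametrizationData W N)
    (hmin : ∀ (W' : WeierstrassCurve ℚ) [W'.IsElliptic], W'.conductorNorm ℤ = N →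
      ∀ P' : ModularParametrizationData W' N, P'.f = P.f → P.modularDegree ≤ P'.modularDegree) :
    ∀ z ∈ P.L.lattice, ∃ w ∈ periodLattice P.f, z = P.c * w := by
  obtain ⟨W₀, hW₀, D₀, hf₀, h₀⟩ := P.exists_optimalDatum hES
  haveI := hW₀
  have hN₀ : W₀.conductorNorm ℤ = N := (hCar D₀.isNewformOf).symm
  exact P.latticeEq_of_modularDegree_le D₀ hf₀ h₀ (hmin W₀ hN₀ D₀ hf₀)

end ModularForms.ModularParametrizationData

/-! ### The facts from the character-group dictionary for lattice-optimal data -/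

/-- **`takahashi2001_thm_2_3_of_coprime` from the dictionary for the optimal quotient.** Assume
(`hES`) the Eichler–Shimura construction with its period lattice and (`hCar`) Carayol's level
theorem (both as in `ModularParametrizationData.latticeEq_of_forall_conductor_modularDegree_le`),
and (`H`) the character-group dictionary of Takahashi §2 / p. 84 **for lattice-optimal data**: for
`W/ℚ` elliptic of conductor `M r` (`r` prime, `gcd(M, r) = 1`) and a datum `P` at level `M r` with
`Λ_W ⊆ c Λ_f` — a `ℚ`-model of the optimal quotient `E_f` with its optimal parametrisation, so
`P.modularDegree = δ_1(N)` — there are, in one Brandt setup `S₀` of type `(M, r)`, a sublattice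
`X ⊆ ℤ^{Cls O}` (the character group `X_r(J₀(Mr))` under Ribet's isometry, Gross's pairing),
adjoint maps `π^* : ℤ → X`, `π_* : X → ℤ` for `u_E(a,b) = ord_r Δ_min(W) · a b`, with
`π_* π^* = P.modularDegree`, `π_*` onto, `π^* 1 = j g`, `g` generating the `a(W)`-eigen-line of the
Brandt matrices. Then the named fact holds: a datum of minimal degree is lattice-optimal
(`latticeEq_of_forall_conductor_modularDegree_le`), and
`takahashi2001_thm_2_3_of_coprime_of_brandtDictionary_one` applies. PROVED; `hES`, `hCar` (named
fact of the tree) and `H` are hypotheses, not new facts. [cite: Takahashi2001, §2 p. 78, Thm. 2.3 (p. 79), remark p. 80, proof of Thm. 3.8 (p. 84)] [cite: Knapp1993, Prop. 12.9(a) and p. 302] -/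
theorem takahashi2001_thm_2_3_of_coprime_of_optimalDictionary
    (hES : ∀ {N : ℕ} [NeZero N] {f : CuspForm (Gamma0 N) 2}, IsNewform0 f →
      (∀ n : ℕ, ∃ a : ℤ, cuspCoeff f n = a) →
      ∃ (W₀ : WeierstrassCurve ℚ) (_ : W₀.IsElliptic), IsNewformOf W₀ f ∧
        ∃ L₀ : PeriodPair, IsNeronLatticeOf (W₀.baseChange ℂ) L₀ ∧
          (L₀.lattice : Set ℂ) = periodLattice f)
    (hCar : ∀ {N : ℕ} [NeZero N], IsNewformOf.level_eq_conductorNorm (N := N))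
    (H : ∀ (W : WeierstrassCurve ℚ) [W.IsElliptic] (M r : ℕ) [NeZero (M * r)],
      r.Prime → M.Coprime r → W.conductorNorm ℤ = M * r →
      ∀ P : ModularParametrizationData W (M * r),
        (∀ z ∈ P.L.lattice, ∃ w ∈ periodLattice P.f, z = P.c * w) →
        Nonempty (Brandt.XiSetup M r) →
        ∃ (S₀ : Brandt.XiSetup M r) (_ : Fintype (Brandt.ClassSet S₀.O))
          (X : Submodule ℤ (Brandt.ClassSet S₀.O → ℤ)) (pb : ℤ →ₗ[ℤ] X) (pf : X →ₗ[ℤ] ℤ)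
          (g : X) (j : ℤ),
          (∀ (a : ℤ) (y : X),
              ∑ i, (Brandt.weight S₀.O i : ℤ) * (pb a : Brandt.ClassSet S₀.O → ℤ) i *
                  (y : Brandt.ClassSet S₀.O → ℤ) i =
                ((W.minimalDiscriminantNorm ℤ).factorization r : ℤ) * a * pf y) ∧
          (∀ a : ℤ, pf (pb a) = (P.modularDegree : ℤ) * a) ∧
          Function.Surjective pf ∧
          pb 1 = j • g ∧
          Brandt.eigenLattice (M * r) (Brandt.matrix S₀.O) (fun n => W.LFunction n) =
            ℤ ∙ (g : Brandt.ClassSet S₀.O → ℤ)) :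
    takahashi2001_thm_2_3_of_coprime := by
  refine takahashi2001_thm_2_3_of_coprime_of_brandtDictionary_one
    fun W _ M r _ hr hcop hN P hmin hne => ?_
  exact H W M r hr hcop hN P
    (P.latticeEq_of_forall_conductor_modularDegree_le hES hCar hmin) hne

/-- **The same with modularity in place of Carayol**: over the tree, Carayol's level theorem
follows from modularity at the conductor level, `exists_isNewformOf` (BCDT 2001 Thm. A at level
`N_E`), by strong multiplicity one across levels
(`IsNewformOf.level_eq_conductorNorm_of_exists_isNewformOf'`). [cite: Takahashi2001, Thm. 2.3 (p. 79) and proof of Thm. 3.8 (p. 84)] -/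
theorem takahashi2001_thm_2_3_of_coprime_of_optimalDictionary'
    (hES : ∀ {N : ℕ} [NeZero N] {f : CuspForm (Gamma0 N) 2}, IsNewform0 f →
      (∀ n : ℕ, ∃ a : ℤ, cuspCoeff f n = a) →
      ∃ (W₀ : WeierstrassCurve ℚ) (_ : W₀.IsElliptic), IsNewformOf W₀ f ∧
        ∃ L₀ : PeriodPair, IsNeronLatticeOf (W₀.baseChange ℂ) L₀ ∧
          (L₀.lattice : Set ℂ) = periodLattice f)
    (hmod : exists_isNewformOf)
    (H : ∀ (W : WeierstrassCurve ℚ) [W.IsElliptic] (M r : ℕ) [NeZero (M * r)],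
      r.Prime → M.Coprime r → W.conductorNorm ℤ = M * r →
      ∀ P : ModularParametrizationData W (M * r),
        (∀ z ∈ P.L.lattice, ∃ w ∈ periodLattice P.f, z = P.c * w) →
        Nonempty (Brandt.XiSetup M r) →
        ∃ (S₀ : Brandt.XiSetup M r) (_ : Fintype (Brandt.ClassSet S₀.O))
          (X : Submodule ℤ (Brandt.ClassSet S₀.O → ℤ)) (pb : ℤ →ₗ[ℤ] X) (pf : X →ₗ[ℤ] ℤ)
          (g : X) (j : ℤ),
          (∀ (a : ℤ) (y : X),
              ∑ i, (Brandt.weight S₀.O i : ℤ) * (pb a : Brandt.ClassSet S₀.O → ℤ) i *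
                  (y : Brandt.ClassSet S₀.O → ℤ) i =
                ((W.minimalDiscriminantNorm ℤ).factorization r : ℤ) * a * pf y) ∧
          (∀ a : ℤ, pf (pb a) = (P.modularDegree : ℤ) * a) ∧
          Function.Surjective pf ∧
          pb 1 = j • g ∧
          Brandt.eigenLattice (M * r) (Brandt.matrix S₀.O) (fun n => W.LFunction n) =
            ℤ ∙ (g : Brandt.ClassSet S₀.O → ℤ)) :
    takahashi2001_thm_2_3_of_coprime :=
  takahashi2001_thm_2_3_of_coprime_of_optimalDictionary hES
    (fun {_} _ => IsNewformOf.level_eq_conductorNorm_of_exists_isNewformOf' hmod) H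

/-- **`takahashi2001_thm_2_3` (square-free `N`) from the dictionary for the optimal quotient**:
as `takahashi2001_thm_2_3_of_coprime_of_optimalDictionary`, for the square-free fact, whose
minimality hypothesis ranges over all curves with the same newform — so Carayol's theorem is not
needed, only `hES` (`ModularParametrizationData.exists_optimalDatum`,
`ModularParametrizationData.latticeEq_of_modularDegree_le`). [cite: Takahashi2001, Thm. 2.3 (p. 79) and proof of Thm. 3.8 (p. 84)] [cite: Knapp1993, Prop. 12.9(a) and p. 302] -/
theorem takahashi2001_thm_2_3_of_optimalDictionary
    (hES : ∀ {N : ℕ} [NeZero N] {f : CuspForm (Gamma0 N) 2}, IsNewform0 f →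
      (∀ n : ℕ, ∃ a : ℤ, cuspCoeff f n = a) →
      ∃ (W₀ : WeierstrassCurve ℚ) (_ : W₀.IsElliptic), IsNewformOf W₀ f ∧
        ∃ L₀ : PeriodPair, IsNeronLatticeOf (W₀.baseChange ℂ) L₀ ∧
          (L₀.lattice : Set ℂ) = periodLattice f)
    (H : ∀ (W : WeierstrassCurve ℚ) [W.IsElliptic] (M r : ℕ) [NeZero (M * r)],
      r.Prime → Squarefree (M * r) → W.conductorNorm ℤ = M * r →
      ∀ P : ModularParametrizationData W (M * r),
        (∀ z ∈ P.L.lattice, ∃ w ∈ periodLattice P.f, z = P.c * w) →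
        Nonempty (Brandt.XiSetup M r) →
        ∃ (S₀ : Brandt.XiSetup M r) (_ : Fintype (Brandt.ClassSet S₀.O))
          (X : Submodule ℤ (Brandt.ClassSet S₀.O → ℤ)) (pb : ℤ →ₗ[ℤ] X) (pf : X →ₗ[ℤ] ℤ)
          (g : X) (j : ℤ),
          (∀ (a : ℤ) (y : X),
              ∑ i, (Brandt.weight S₀.O i : ℤ) * (pb a : Brandt.ClassSet S₀.O → ℤ) i *
                  (y : Brandt.ClassSet S₀.O → ℤ) i =
                ((W.minimalDiscriminantNorm ℤ).factorization r : ℤ) * a * pf y) ∧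
          (∀ a : ℤ, pf (pb a) = (P.modularDegree : ℤ) * a) ∧
          Function.Surjective pf ∧
          pb 1 = j • g ∧
          Brandt.eigenLattice (M * r) (Brandt.matrix S₀.O) (fun n => W.LFunction n) =
            ℤ ∙ (g : Brandt.ClassSet S₀.O → ℤ)) :
    takahashi2001_thm_2_3 := by
  refine takahashi2001_thm_2_3_of_brandtDictionary_one fun W _ M r _ hr hsq hN P hmin hne => ?_
  obtain ⟨W₀, hW₀, D₀, hf₀, h₀⟩ := P.exists_optimalDatum hES
  haveI := hW₀
  exact H W M r hr hsq hN P (P.latticeEq_of_modularDegree_le D₀ hf₀ h₀ (hmin W₀ D₀ hf₀)) hne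

end Literature.NumberTheory.EllipticCurves

end
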